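import Summits.Langlands.Langlands.Statement
import Literature.NumberTheory.Automorphic.AutomorphicRepsGLSatakeFlathProofs
import Summits.Langlands.Langlands.Theorems.ParityBlindBianchiArtinWeightRealisationEvenStubFrobeniusSignTransfer
import Summits.Langlands.Langlands.Theorems.ParityBlindBianchiArtinWeightRealisationEvenStubScalarOnProjectiveKernel
import Summits.Langlands.Langlands.Theorems.ParityBlindBianchiArtinWeightRealisationEvenStubTwistedRealisation
import Summits.Langlands.Langlands.Theorems.ParityBlindBianchiArtinWeightRealisationEvenStubTwistConjugateOfSignedTraces
import HarnessLib

/-!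
# `PinnedRealisation` (repaired) — the checkable half of the line `SketchIdeator2` for the crux
# `ParityBlindBianchi.ArtinWeightRealisationEven` (item stmt-Langlands-16619), as ONE theorem

Helper file (`--supports stmt-Langlands-16619`, registered sub-goal `stub_pinnedRealisation`).  For ANY number
field `K`, prime `p`, `ι : ℚ̄_p ≃ ℂ`, a finite-image `σ : Γ_K → GL₂(ℚ̄_p)` with projective image `A₅`, a finite set
`S₀` of naturals with `0 ∉ S₀` (good places = places of `K` over no element of `S₀`), a cuspidal `π` of `GL₂(𝔸_K)`
and a framed `r : Γ_K → GL₂(ℚ̄_p)`: if at every good place `π` is Satake–Frobenius compatible with `r` AND with `σ`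
up to the sign of the trace, then some cuspidal `π'` (a quadratic twist of `π`) is Satake–Frobenius compatible with
`σ` at every good place.  This is the idea card's `PinnedRealisation` (`Cruxes/ArtinWeightRealisationEven/
SketchIdeator2.lean`) with its `QuadraticTwistPinning` input PROVED and repaired (`0 ∉ S₀`): the composite of the
landed stubs S3 (`stub_frobeniusSignTransfer`, Chebotarev), S4a/S4b (`stub_scalarOnProjectiveKernel`,
`stub_twistConjugateOfSignedTraces`, the group-theoretic pinning) and S5 (`stub_twistedRealisation`, Artin
reciprocity + Borel–Jacquet twist), glued by Flath's uniqueness of Satake parameters.  With it the line reads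
`R″ ⟸ S1 ∧ S2 ∧ S7 ∧ stub_pinnedRealisation`.  No definition, no named fact.
-/

-- the line's namespace `Summit.Langlands.Langlands.…` (summit = problem = `Langlands`) repeats a
-- component by design
set_option linter.dupNamespace false

namespace Summit.Langlands.Langlands.Theorems.ArtinWeightRealisationEven

open scoped MatrixGroups Matrix Polynomial NumberField
open NumberField IsDedekindDomain Polynomial Field
open Literature.NumberTheory.Automorphic Literature.NumberTheory.GaloisRepresentations

/-- **Pinned realisation (registered sub-goal `stub_pinnedRealisation`).**  If a cuspidal `π` of `GL₂(𝔸_K)` is,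
at every good place, Satake–Frobenius compatible with some framed `r` and compatible with the finite-image
icosahedral `σ` up to the sign of the trace, then a cuspidal `π'` is Satake–Frobenius compatible with `σ` at every
good place. -/
theorem stub_pinnedRealisation :
    ∀ (K : Type) [Field K] [NumberField K] (p : ℕ) [Fact p.Prime] (ι : PadicAlgCl p ≃+* ℂ) (σ r : FramedGaloisRep K (PadicAlgCl p) 2), Finite σ.toMonoidHom.range → Nonempty ((Matrix.ProjGenLinGroup.mk.comp σ.toMonoidHom).range ≃* alternatingGroup (Fin 5)) → ∀ (S₀ : Finset ℕ), (0 : ℕ) ∉ S₀ → ∀ (hcpt : isCompact_glFiniteIntegralLevel 2 K) (π : CuspidalAutomorphicRepData 2 K hcpt), (∀ w : HeightOneSpectrum (𝓞 K), (∀ ℓ ∈ S₀, ((ℓ : ℕ) : 𝓞 K) ∉ w.asIdeal) → (∃ α : Multiset ℂ, π.1.HasSatakeParamAt w α ∧ σ.IsUnramifiedAt w ∧ (σ.HasFrobCharpolyAt w (arithFrobPolyOfSatake ι w.residueCard 1 α) ∨ σ.HasFrobCharpolyAt w ((arithFrobPolyOfSatake ι w.residueCard 1 α).comp (-X)))) ∧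 SatakeFrobCompatibleAt ι π.1 r w) → ∃ (hcpt' : isCompact_glFiniteIntegralLevel 2 K) (π' : CuspidalAutomorphicRepData 2 K hcpt'), ∀ w : HeightOneSpectrum (𝓞 K), (∀ ℓ ∈ S₀, ((ℓ : ℕ) : 𝓞 K) ∉ w.asIdeal) → SatakeFrobCompatibleAt ι π'.1 σ w := by
  intro K _ _ p _ ι σ r hσfin hσA5 S₀ h0S₀ hcpt π hπ
  -- Flath: Frobenius polynomials of `r` and `σ` agree up to `X ↦ -X` at the good places
  have hfrob : ∀ v : HeightOneSpectrum (𝓞 K), (∀ ℓ ∈ S₀, ((ℓ : ℕ) : 𝓞 K) ∉ v.asIdeal) →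
      ∃ P : (PadicAlgCl p)[X], r.HasFrobCharpolyAt v P ∧
        (σ.HasFrobCharpolyAt v P ∨ σ.HasFrobCharpolyAt v (P.comp (-X))) := by
    intro v hv
    obtain ⟨⟨α, hα, -, hσP⟩, β, hβ, -, hrP⟩ := hπ v hv
    have hαβ : α = β := π.1.hasSatakeParamAt_unique_holds hα hβ
    subst hαβ
    exact ⟨_, hrP, hσP⟩
  -- Chebotarev transfer, pinning, twisting
  have hsign := stub_frobeniusSignTransfer K p σ r S₀ h0S₀ hfrob
  have hcen := stub_scalarOnProjectiveKernel (absoluteGaloisGroup K) (PadicAlgCl p)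
    σ.toMonoidHom r.toMonoidHom hσfin hσA5 hsign
  obtain ⟨χ, M, hχ2, hrχ⟩ := stub_twistConjugateOfSignedTraces (absoluteGaloisGroup K) (PadicAlgCl p)
    σ.toMonoidHom r.toMonoidHom hσfin hσA5 hsign hcen
  refine stub_twistedRealisation K p ι σ r χ M hχ2 hrχ S₀ hcpt π (fun w hw => ⟨?_, (hπ w hw).2⟩)
  obtain ⟨⟨-, -, hu, -⟩, -⟩ := hπ w hw
  exact hu

end Summit.Langlands.Langlands.Theorems.ArtinWeightRealisationEven
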